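import Literature.Computability.Complexity.TVHardnessTokens
import Literature.Computability.Complexity.TVCheckerPointBricks
import HarnessLib

/-!
# Scanning the prefix code of a formula in polynomial time: tokens, suffixes, span lengths

Literature / complexity — third file of the `PSPACE`-hardness of Trevisan–Vadhan's `LTV`: the
string bricks (in the `FP` algebra of the tree) that read the prefix code `PropForm.code φ` token by
token, so that the positions formula of `TVHardnessTokens.lean` (`PreTseitin.blockAt`: the pre-order
Tseitin clauses of the node at position `t` from its token, `t` and one span length) becomes a
polynomial-time function of the code:

* `TVHard.tcode L` (the code of a token list; `code_eq_tcode`), `TVHard.pfx l` (prefix test),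
  **`TVHard.strip1`** (drop the first token; `strip1_tcode_cons`), `payload1` (the variable index of a
  leading variable token), `arityU` (the arity of the leading token in unary), the token-kind tests
  `isVarT`, `isConstT`, `isNegT`, `isConjT`, `constBitT`;
* **`TVHard.suffixF`**: `⟨tcode L, 1ᵗ⟩ ↦ tcode (L ⇂ t)` (a counted fold of `strip1`; `suffixF_apply`);
* **`TVHard.spanLenF`**: `tcode L ↦ 1^{spanLen L}` (the open-places scan as a counted fold;
  `spanLenF_apply`).

Everything is proved; no named fact is introduced (D-0026).

## References

* S. Arora, B. Barak, CUP 2009, §0.1 (prefix codes), §1.3 (bounded loops) [AroraBarakCC2009].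
* L. Trevisan, S. Vadhan, Comput. Complexity 16 (2007), §4, Lemma 4.1 (ii) [TrevisanVadhan2007].
-/

noncomputable section

namespace Literature.Computability.Complexity

namespace TVHard

open _root_.Computability Polynomial Brick Plumb PreTseitin TVChk

/-! ### Codes of token lists -/

/-- The code of a token list. [cite: AroraBarakCC2009, §0.1] -/
def tcode (L : List PreTseitin.Tok) : List Bool := (L.map tokCode).flatten

/-- Empty list. [folklore] -/
@[simp] theorem tcode_nil : tcode [] = [] := rfl

/-- One more token. [folklore] -/
theorem tcode_cons (tk : PreTseitin.Tok) (L : List PreTseitin.Tok) : tcode (tk :: L) = tokCode tk ++ tcode L := by simp [tcode]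

/-- The prefix code of a formula is the code of its token list. [cite: AroraBarakCC2009, §0.1] -/
theorem code_eq_tcode (φ : PropForm ℕ) : PropForm.code φ = tcode (toks φ) := code_eq_flatten_toks φ

/-- Every token code has at least two symbols, so `|L| ≤ |tcode L|`. [folklore] -/
theorem length_le_length_tcode (L : List PreTseitin.Tok) : L.length ≤ (tcode L).length := by
  induction L with
  | nil => simp
  | cons tk L ih =>
    rw [tcode_cons, List.length_append, List.length_cons]
    have : 1 ≤ (tokCode tk).length := by cases tk <;> simp [tokCode]
    omega

/-- Appending after a pair extends its second component. [folklore] -/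
theorem boolPair_append' (x y z : List Bool) : boolPair x y ++ z = boolPair x (y ++ z) := by
  simp [boolPair, List.append_assoc]

/-- The code of a leading variable token, regrouped. [folklore] -/
theorem tcode_var_cons (n : ℕ) (L : List PreTseitin.Tok) : tcode (.var n :: L) = false :: false :: boolPair (encodeNat n) (tcode L) := by
  rw [tcode_cons, tokCode, List.cons_append, List.cons_append, boolPair_append', List.nil_append]

/-- Token kinds as bits. [folklore] -/
def kindBits : PreTseitin.Tok → Bool × Bool × Bool × Bool
  | .var _ => (true, false, false, false)
  | .const _ => (false, true, false, false)
  | .neg => (false, false, true, false)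
  | .conj => (false, false, false, true)
  | .disj => (false, false, false, false)

/-! ### Prefix tests and the first token -/

/-- The test `[w begins with l]`. [folklore] -/
def pfx (l : List Bool) : List Bool → List Bool := eqPairFn ∘ fanoutFn (takeFn ∘ fanoutFn (fun _ => ones l.length) (fun w => w)) (fun _ => l)

/-- `pfx l ∈ FP`. [folklore] -/
theorem pfx_mem_FP (l : List Bool) : pfx l ∈ FP :=
  comp_mem_FP eqPairFn_mem_FP (fanoutFn_mem_FP (comp_mem_FP takeFn_mem_FP (fanoutFn_mem_FP (const_mem_FP _) (PolyTimeComputable.id _)))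
    (const_mem_FP _))

/-- Value of the prefix test. [folklore] -/
theorem pfx_apply (l w : List Bool) : pfx l w = [decide (w.take l.length = l)] := by
  simp [pfx, ones, eqPairFn_boolPair]

/-- **Dropping the first token**: a variable token `00⟨bin n, ·⟩` is undone by the pair projection,
`10` drops two symbols, `01b` / `110` / `111` drop three. [cite: AroraBarakCC2009, §0.1] -/
def strip1 : List Bool → List Bool :=
  iteFn (pfx [false, false]) (sndF ∘ dropFn ∘ fanoutFn (fun _ => ones 2) (fun w => w))
    (iteFn (pfx [true, false]) (dropFn ∘ fanoutFn (fun _ => ones 2) (fun w => w)) (dropFn ∘ fanoutFn (fun _ => ones 3) (fun w => w)))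

/-- `strip1 ∈ FP`. [folklore] -/
theorem strip1_mem_FP : strip1 ∈ FP :=
  iteFn_mem_FP (pfx_mem_FP _) (comp_mem_FP sndF_mem_FP (comp_mem_FP dropFn_mem_FP (fanoutFn_mem_FP (const_mem_FP _) (PolyTimeComputable.id _))))
    (iteFn_mem_FP (pfx_mem_FP _) (comp_mem_FP dropFn_mem_FP (fanoutFn_mem_FP (const_mem_FP _) (PolyTimeComputable.id _)))
      (comp_mem_FP dropFn_mem_FP (fanoutFn_mem_FP (const_mem_FP _) (PolyTimeComputable.id _))))

/-- The two prefix tests of `strip1` / `arityU` on token-list codes. [folklore] -/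
theorem pfx_tcode_cons (tk : PreTseitin.Tok) (L : List PreTseitin.Tok) :
    pfx [false, false] (tcode (tk :: L)) = [(kindBits tk).1] ∧ pfx [true, false] (tcode (tk :: L)) = [(kindBits tk).2.2.1] ∧
    pfx [true, true] (tcode (tk :: L)) = [decide (tk = .conj ∨ tk = .disj)] ∧ pfx [false, true] (tcode (tk :: L)) = [(kindBits tk).2.1] ∧
    pfx [true, true, false] (tcode (tk :: L)) = [(kindBits tk).2.2.2] := by
  cases tk with
  | var n => rw [tcode_var_cons]; simp [pfx_apply, kindBits]
  | const b => rw [tcode_cons, tokCode]; simp [pfx_apply, kindBits]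
  | neg => rw [tcode_cons, tokCode]; simp [pfx_apply, kindBits]
  | conj => rw [tcode_cons, tokCode]; simp [pfx_apply, kindBits]
  | disj => rw [tcode_cons, tokCode]; simp [pfx_apply, kindBits]

/-- **`strip1` drops the first token of a token-list code.** [cite: AroraBarakCC2009, §0.1] -/
theorem strip1_tcode_cons (tk : PreTseitin.Tok) (L : List PreTseitin.Tok) : strip1 (tcode (tk :: L)) = tcode L := by
  obtain ⟨h00, h10, -, -, -⟩ := pfx_tcode_cons tk L
  cases tk with
  | var n =>
    rw [strip1, iteFn_apply_true h00, tcode_var_cons]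
    simp [ones]
  | const b =>
    rw [strip1, iteFn_apply_false h00, iteFn_apply_false h10, tcode_cons, tokCode]
    simp [ones]
  | neg =>
    rw [strip1, iteFn_apply_false h00, iteFn_apply_true h10, tcode_cons, tokCode]
    simp [ones]
  | conj =>
    rw [strip1, iteFn_apply_false h00, iteFn_apply_false h10, tcode_cons, tokCode]
    simp [ones]
  | disj =>
    rw [strip1, iteFn_apply_false h00, iteFn_apply_false h10, tcode_cons, tokCode]
    simp [ones]

/-- `strip1 ε = ε`. [folklore] -/
theorem strip1_nil : strip1 [] = [] := by
  have h1 : pfx [false, false] [] = [false] := by rw [pfx_apply]; simp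
  have h2 : pfx [true, false] [] = [false] := by rw [pfx_apply]; simp
  rw [strip1, iteFn_apply_false h1, iteFn_apply_false h2]
  simp [ones]

/-- `strip1` never lengthens. [folklore] -/
theorem length_strip1_le (w : List Bool) : (strip1 w).length ≤ w.length := by
  rw [strip1, iteFn_apply (pfx_apply _ _)]
  split_ifs
  · simp only [Function.comp_apply, fanoutFn_apply, dropFn_boolPair]
    have h1 := length_fstF_sndF_le (w.drop (ones 2).length)
    have h2 := List.length_drop (i := (ones 2).length) (l := w)
    omega
  · rw [iteFn_apply (pfx_apply _ _)]
    split_ifs <;> simp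

/-- Iterated stripping drops tokens. [folklore] -/
theorem iterate_strip1_tcode (L : List PreTseitin.Tok) : ∀ t : ℕ, strip1^[t] (tcode L) = tcode (L.drop t) := by
  intro t
  induction t generalizing L with
  | zero => rfl
  | succ t ih =>
    rw [Function.iterate_succ_apply]
    cases L with
    | nil => rw [tcode_nil, strip1_nil, ← tcode_nil, ih]; simp
    | cons tk L => rw [strip1_tcode_cons, ih]; rfl

/-- **The variable index of a leading variable token.** [cite: AroraBarakCC2009, §0.1] -/
def payload1 : List Bool → List Bool := fstF ∘ dropFn ∘ fanoutFn (fun _ => ones 2) (fun w => w)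

/-- `payload1 ∈ FP`. [folklore] -/
theorem payload1_mem_FP : payload1 ∈ FP :=
  comp_mem_FP fstF_mem_FP (comp_mem_FP dropFn_mem_FP (fanoutFn_mem_FP (const_mem_FP _) (PolyTimeComputable.id _)))

/-- Value on a leading variable token. [folklore] -/
theorem payload1_var (n : ℕ) (L : List PreTseitin.Tok) : payload1 (tcode (.var n :: L)) = encodeNat n := by
  rw [tcode_var_cons, payload1]; simp [ones]

/-- **The arity of the leading token, in unary** (`10 ↦ 1`, `11· ↦ 11`, else `ε`). [folklore] -/
def arityU : List Bool → List Bool :=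
  iteFn (pfx [true, false]) (fun _ => ones 1) (iteFn (pfx [true, true]) (fun _ => ones 2) (fun _ => []))

/-- `arityU ∈ FP`. [folklore] -/
theorem arityU_mem_FP : arityU ∈ FP :=
  iteFn_mem_FP (pfx_mem_FP _) (const_mem_FP _) (iteFn_mem_FP (pfx_mem_FP _) (const_mem_FP _) (const_mem_FP _))

/-- Value on a token-list code. [folklore] -/
theorem arityU_tcode_cons (tk : PreTseitin.Tok) (L : List PreTseitin.Tok) : arityU (tcode (tk :: L)) = ones tk.arity := by
  obtain ⟨-, h10, h11, -, -⟩ := pfx_tcode_cons tk L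
  cases tk with
  | var n => rw [arityU, iteFn_apply_false h10, iteFn_apply_false (by rw [h11]; rfl)]; rfl
  | const b => rw [arityU, iteFn_apply_false h10, iteFn_apply_false (by rw [h11]; rfl)]; rfl
  | neg => rw [arityU, iteFn_apply_true h10]; rfl
  | conj => rw [arityU, iteFn_apply_false h10, iteFn_apply_true (by rw [h11]; simp)]; rfl
  | disj => rw [arityU, iteFn_apply_false h10, iteFn_apply_true (by rw [h11]; simp)]; rfl

/-- The arity string has at most two symbols. [folklore] -/
theorem length_arityU_le (w : List Bool) : (arityU w).length ≤ 2 := by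
  rw [arityU, iteFn_apply (pfx_apply _ _)]
  split_ifs
  · simp [ones]
  · rw [iteFn_apply (pfx_apply _ _)]; split_ifs <;> simp [ones]

/-- Token-kind tests and the constant's bit, on the code of a nonempty token list. [folklore] -/
def isVarT : List Bool → List Bool := pfx [false, false]
/-- `[leading token is a constant]`. [folklore] -/
def isConstT : List Bool → List Bool := pfx [false, true]
/-- `[leading token is ¬]`. [folklore] -/
def isNegT : List Bool → List Bool := pfx [true, false]
/-- `[leading token is ∧]`. [folklore] -/
def isConjT : List Bool → List Bool := pfx [true, true, false]
/-- The bit of a leading constant token (third symbol). [folklore] -/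
def constBitT : List Bool → List Bool := take1Fn ∘ dropFn ∘ fanoutFn (fun _ => ones 2) (fun w => w)

/-- These are in `FP`. [folklore] -/
theorem kindT_mem_FP : isVarT ∈ FP ∧ isConstT ∈ FP ∧ isNegT ∈ FP ∧ isConjT ∈ FP ∧ constBitT ∈ FP :=
  ⟨pfx_mem_FP _, pfx_mem_FP _, pfx_mem_FP _, pfx_mem_FP _,
    comp_mem_FP take1Fn_mem_FP (comp_mem_FP dropFn_mem_FP (fanoutFn_mem_FP (const_mem_FP _) (PolyTimeComputable.id _)))⟩

/-- Values of the kind tests. [folklore] -/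
theorem kindT_apply (tk : PreTseitin.Tok) (L : List PreTseitin.Tok) :
    isVarT (tcode (tk :: L)) = [(kindBits tk).1] ∧ isConstT (tcode (tk :: L)) = [(kindBits tk).2.1] ∧
    isNegT (tcode (tk :: L)) = [(kindBits tk).2.2.1] ∧ isConjT (tcode (tk :: L)) = [(kindBits tk).2.2.2] := by
  obtain ⟨h00, h10, -, h01, h110⟩ := pfx_tcode_cons tk L
  exact ⟨h00, h01, h10, h110⟩

/-- The constant's bit. [folklore] -/
theorem constBitT_apply (b : Bool) (L : List PreTseitin.Tok) : constBitT (tcode (.const b :: L)) = [b] := by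
  rw [tcode_cons, tokCode, constBitT]; simp [ones, take1Fn]

/-! ### Suffixes: dropping `t` tokens -/

/-- The round of the suffix fold: strip the accumulator (the piece is ignored). [folklore] -/
def sufOp : List Bool → List Bool := strip1 ∘ fstF

/-- Growth of the round: none. [folklore] -/
theorem length_sufOp_le (w : List Bool) : (sufOp w).length ≤ (fstF w).length + (sndF w).length + 0 := by
  rw [sufOp, Function.comp_apply]; have := length_strip1_le (fstF w); omega

/-- The model of the suffix fold. [folklore] -/
theorem suf_foldAcc (x : List Bool) (f : List Bool → List Bool) : ∀ (i k : ℕ) (acc : List Bool),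
    foldAcc sufOp f x i k acc = strip1^[k] acc
  | i, 0, acc => rfl
  | i, k + 1, acc => by
    rw [foldAcc_succ, suf_foldAcc x f (i + 1) k, sufOp, Function.comp_apply, fstF_boolPair, ← Function.iterate_succ_apply]

/-- Initialisation: on `⟨w, 1ᵗ⟩`, the record `⟨w, ⟨bin t, ⟨ε, w⟩⟩⟩`. [folklore] -/
def sufInit : List Bool → List Bool := fanoutFn fstF (fanoutFn (lenBinF ∘ sndF) (fanoutFn (fun _ => []) fstF))

/-- **The suffix after `t` tokens**: `⟨tcode L, 1ᵗ⟩ ↦ tcode (L ⇂ t)`. [cite: AroraBarakCC2009, §0.1, §1.3] -/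
def suffixF : List Bool → List Bool := sndPow 2 ∘ foldLoop sufOp (clipF 1 fun _ => []) X ∘ sufInit

/-- `suffixF ∈ FP`. [folklore] -/
theorem suffixF_mem_FP : suffixF ∈ FP :=
  comp_mem_FP (sndPow_mem_FP 2) (comp_mem_FP (foldLoop_clipF_mem_FP 1 (comp_mem_FP strip1_mem_FP fstF_mem_FP) length_sufOp_le (const_mem_FP _) _)
    (fanoutFn_mem_FP fstF_mem_FP (fanoutFn_mem_FP (comp_mem_FP lenBinF_mem_FP sndF_mem_FP) (fanoutFn_mem_FP (const_mem_FP _) fstF_mem_FP))))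

/-- **Value of `suffixF`** (`t ≤ |tcode L|`, e.g. `t ≤ |L|`). [folklore] -/
theorem suffixF_apply (L : List PreTseitin.Tok) {t : ℕ} (ht : t ≤ (tcode L).length) : suffixF (boolPair (tcode L) (ones t)) = tcode (L.drop t) := by
  have hinit : sufInit (boolPair (tcode L) (ones t)) = boolPair (tcode L) (boolPair (encodeNat t) (boolPair (ones 0) (tcode L))) := by
    simp [sufInit, ones]
  have hk : t ≤ (X : Polynomial ℕ).eval (tcode L).length := by simpa using ht
  rw [suffixF, Function.comp_apply, Function.comp_apply, hinit, foldLoop_apply _ _ hk, sndPow_succ_boolPair, sndPow_succ_boolPair,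
    sndPow_zero_boolPair, foldAcc_clipF (fun j _ _ => by simp), suf_foldAcc, iterate_strip1_tcode]

/-! ### Span lengths -/

/-- One step of the open-places scan on `⟨rem, ⟨1^{need}, 1^{cnt}⟩⟩`: stop when `need = 0` or the code
is exhausted, else strip a token, `need += arity − 1`, `cnt += 1`. [cite: AroraBarakCC2009, §0.1] -/
def spStep : List Bool → List Bool :=
  iteFn (isNilFn ∘ fstF) (fun s => s)
    (iteFn (isNilFn ∘ fstF ∘ sndF) (fun s => s)
      (fanoutFn (strip1 ∘ fstF)
        (fanoutFn (appF ∘ fanoutFn (dropFn ∘ fanoutFn (fun _ => ones 1) (fstF ∘ sndF)) (arityU ∘ fstF)) (List.cons true ∘ sndF ∘ sndF))))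

/-- `spStep ∈ FP`. [folklore] -/
theorem spStep_mem_FP : spStep ∈ FP :=
  iteFn_mem_FP (comp_mem_FP isNilFn_mem_FP fstF_mem_FP) (PolyTimeComputable.id _)
    (iteFn_mem_FP (comp_mem_FP isNilFn_mem_FP (comp_mem_FP fstF_mem_FP sndF_mem_FP)) (PolyTimeComputable.id _)
      (fanoutFn_mem_FP (comp_mem_FP strip1_mem_FP fstF_mem_FP)
        (fanoutFn_mem_FP (comp_mem_FP appF_mem_FP (fanoutFn_mem_FP (comp_mem_FP dropFn_mem_FP (fanoutFn_mem_FP (const_mem_FP _)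
          (comp_mem_FP fstF_mem_FP sndF_mem_FP))) (comp_mem_FP arityU_mem_FP fstF_mem_FP))) (comp_mem_FP (cons_mem_FP true) (comp_mem_FP sndF_mem_FP sndF_mem_FP)))))

/-- The mathematical step on `(tokens, need, count)`. [folklore] -/
def spModel : List PreTseitin.Tok × ℕ × ℕ → List PreTseitin.Tok × ℕ × ℕ
  | ([], need, cnt) => ([], need, cnt)
  | (L, 0, cnt) => (L, 0, cnt)
  | (tk :: L, need + 1, cnt) => (L, need + tk.arity, cnt + 1)

/-- The code of a scan state. [folklore] -/
def spEnc (s : List PreTseitin.Tok × ℕ × ℕ) : List Bool := boolPair (tcode s.1) (boolPair (ones s.2.1) (ones s.2.2))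

/-- Model step, exhausted code. [folklore] -/
theorem spModel_nil (need cnt : ℕ) : spModel ([], need, cnt) = ([], need, cnt) := by cases need <;> rfl
/-- Model step, no open place. [folklore] -/
theorem spModel_zero (tk : PreTseitin.Tok) (L : List PreTseitin.Tok) (cnt : ℕ) : spModel (tk :: L, 0, cnt) = (tk :: L, 0, cnt) := rfl
/-- Model step, generic. [folklore] -/
theorem spModel_succ (tk : PreTseitin.Tok) (L : List PreTseitin.Tok) (need cnt : ℕ) :
    spModel (tk :: L, need + 1, cnt) = (L, need + tk.arity, cnt + 1) := rfl
/-- `spanAux` on the empty list. [folklore] -/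
theorem spanAux_nil' (need : ℕ) : spanAux [] need = 0 := by cases need <;> rfl
/-- `spanAux`, generic step. [folklore] -/
theorem spanAux_cons_succ (tk : PreTseitin.Tok) (L : List PreTseitin.Tok) (need : ℕ) :
    spanAux (tk :: L) (need + 1) = spanAux L (need + tk.arity) + 1 := rfl

/-- **`spStep` realizes the model step.** [folklore] -/
theorem spStep_spEnc (s : List PreTseitin.Tok × ℕ × ℕ) : spStep (spEnc s) = spEnc (spModel s) := by
  obtain ⟨L, need, cnt⟩ := s
  have h1 : (isNilFn ∘ fstF) (spEnc (L, need, cnt)) = [decide (tcode L = [])] := by simp [spEnc, isNilFn]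
  rw [spStep, iteFn_apply h1]
  cases L with
  | nil => simp [spEnc, spModel_nil]
  | cons tk L =>
    have hne : tcode (tk :: L) ≠ [] := by
      rw [tcode_cons]; cases tk <;> simp [tokCode]
    rw [decide_eq_false hne, if_neg Bool.false_ne_true]
    have h2 : (isNilFn ∘ fstF ∘ sndF) (spEnc (tk :: L, need, cnt)) = [decide (need = 0)] := by
      simp [spEnc, isNilFn, ones, List.replicate_eq_nil_iff]
    rw [iteFn_apply h2]
    cases need with
    | zero => simp [spEnc, spModel_zero]
    | succ need =>
      rw [decide_eq_false (Nat.succ_ne_zero _), if_neg Bool.false_ne_true]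
      simp only [spEnc, spModel_succ, fanoutFn_apply, Function.comp_apply, fstF_boolPair, sndF_boolPair, strip1_tcode_cons, arityU_tcode_cons,
        dropFn_boolPair, appF_boolPair]
      have e1 : (ones (need + 1)).drop (ones 1).length ++ ones tk.arity = ones (need + tk.arity) := by
        rw [ones, ones, ones, ones, List.length_replicate, List.drop_replicate, Nat.add_sub_cancel, ← List.replicate_add]
      have e2 : true :: ones cnt = ones (cnt + 1) := by rw [ones, ones, List.replicate_succ]
      rw [e1, e2]

/-- Growth of the step: at most nine more symbols. [folklore] -/
theorem length_spStep_le (s : List Bool) : (spStep s).length ≤ s.length + 9 := by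
  rw [spStep, iteFn_of_oneBit (oneBit_isNilFn.comp _)]
  split_ifs
  · simp
  · rw [iteFn_of_oneBit (oneBit_isNilFn.comp _)]
    split_ifs
    · simp
    · simp only [fanoutFn_apply, Function.comp_apply, length_boolPair, List.length_cons, dropFn_boolPair, appF_boolPair, List.length_append,
        List.length_drop]
      have h0 := length_fstF_sndF_le s
      have h1 := length_fstF_sndF_le (sndF s)
      have h2 := length_strip1_le (fstF s)
      have h3 := length_arityU_le (fstF s)
      simp only [ones, List.length_replicate]
      omega

/-- The model reaches the span length: after at least `|L|` steps from `(L, need, cnt)` the count is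
`cnt + spanAux L need`. [cite: AroraBarakCC2009, §0.1] -/
theorem iterate_spModel (L : List PreTseitin.Tok) : ∀ (need cnt k : ℕ), L.length ≤ k → (spModel^[k] (L, need, cnt)).2.2 = cnt + spanAux L need := by
  induction L with
  | nil =>
    intro need cnt k _
    have hfix : ∀ k, spModel^[k] (([] : List PreTseitin.Tok), need, cnt) = ([], need, cnt) := by
      intro k; induction k with
      | zero => rfl
      | succ k ih => rw [Function.iterate_succ_apply, spModel_nil, ih]
    rw [hfix, spanAux_nil']; rfl
  | cons tk L ih =>
    intro need cnt k hk
    cases k with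
    | zero => simp at hk
    | succ k =>
      rw [Function.iterate_succ_apply]
      cases need with
      | zero =>
        have hfix : ∀ k, spModel^[k] ((tk :: L), 0, cnt) = (tk :: L, 0, cnt) := by
          intro k; induction k with
          | zero => rfl
          | succ k ih' => rw [Function.iterate_succ_apply, spModel_zero, ih']
        rw [spModel_zero, hfix, spanAux_zero]; rfl
      | succ need =>
        rw [spModel_succ, ih _ _ k (by simpa using hk), spanAux_cons_succ]; omega

/-- The round of the span fold: step the accumulator (the piece is ignored). [folklore] -/
def spOp : List Bool → List Bool := spStep ∘ fstF

/-- Growth of the round. [folklore] -/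
theorem length_spOp_le (w : List Bool) : (spOp w).length ≤ (fstF w).length + (sndF w).length + 9 := by
  rw [spOp, Function.comp_apply]; have := length_spStep_le (fstF w); omega

/-- The model of the span fold. [folklore] -/
theorem sp_foldAcc (x : List Bool) (f : List Bool → List Bool) (s : List PreTseitin.Tok × ℕ × ℕ) : ∀ (i k : ℕ),
    foldAcc spOp f x i k (spEnc s) = spEnc (spModel^[k] s)
  | i, 0 => rfl
  | i, k + 1 => by
    rw [foldAcc_succ]
    have h : spOp (boolPair (spEnc s) (f (boolPair x (ones i)))) = spEnc (spModel s) := by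
      rw [spOp, Function.comp_apply, fstF_boolPair, spStep_spEnc]
    rw [h, sp_foldAcc x f (spModel s) (i + 1) k, ← Function.iterate_succ_apply]

/-- Initialisation: on `w`, the record `⟨w, ⟨bin |w|, ⟨ε, ⟨w, ⟨1, ε⟩⟩⟩⟩⟩`. [folklore] -/
def spInit : List Bool → List Bool :=
  fanoutFn (fun w => w) (fanoutFn lenBinF (fanoutFn (fun _ => []) (fanoutFn (fun w => w) (fun _ => boolPair (ones 1) []))))

/-- **The span length of a token-list code, in unary**: `tcode L ↦ 1^{spanLen L}`. [cite: AroraBarakCC2009, §0.1, §1.3] -/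
def spanLenF : List Bool → List Bool := sndF ∘ sndF ∘ sndPow 2 ∘ foldLoop spOp (clipF 1 fun _ => []) X ∘ spInit

/-- `spanLenF ∈ FP`. [folklore] -/
theorem spanLenF_mem_FP : spanLenF ∈ FP :=
  comp_mem_FP sndF_mem_FP (comp_mem_FP sndF_mem_FP (comp_mem_FP (sndPow_mem_FP 2)
    (comp_mem_FP (foldLoop_clipF_mem_FP 1 (comp_mem_FP spStep_mem_FP fstF_mem_FP) length_spOp_le (const_mem_FP _) _)
      (fanoutFn_mem_FP (PolyTimeComputable.id _) (fanoutFn_mem_FP lenBinF_mem_FP (fanoutFn_mem_FP (const_mem_FP _)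
        (fanoutFn_mem_FP (PolyTimeComputable.id _) (const_mem_FP _))))))))

/-- **Value of `spanLenF`.** [folklore] -/
theorem spanLenF_apply (L : List PreTseitin.Tok) : spanLenF (tcode L) = ones (spanLen L) := by
  have hinit : spInit (tcode L) = boolPair (tcode L) (boolPair (encodeNat (tcode L).length) (boolPair (ones 0) (spEnc (L, 1, 0)))) := by
    simp [spInit, spEnc, ones]
  have hk : (tcode L).length ≤ (X : Polynomial ℕ).eval (tcode L).length := by simp
  rw [spanLenF, Function.comp_apply, Function.comp_apply, Function.comp_apply, Function.comp_apply, hinit, foldLoop_apply _ _ hk,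
    sndPow_succ_boolPair, sndPow_succ_boolPair, sndPow_zero_boolPair, foldAcc_clipF (fun j _ _ => by simp), sp_foldAcc]
  set s := spModel^[(tcode L).length] (L, 1, 0) with hs
  have hcnt : s.2.2 = spanLen L := by
    rw [hs, iterate_spModel L 1 0 _ (length_le_length_tcode L), spanLen, Nat.zero_add]
  rw [spEnc, sndF_boolPair, sndF_boolPair, hcnt]

end TVHard

end Literature.Computability.Complexity

end
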